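import Summits.AtomisticToContinuum.Crystallization.Theses.ChessboardParticlePlanes
import Summits.AtomisticToContinuum.Crystallization.Theorems.ChessboardParticlePlanesLjPlaneChessboardSumToMinLayers
import Summits.AtomisticToContinuum.Crystallization.Theorems.ChessboardParticlePlanesLjPlaneChessboardAdjacentHeights

/-!
# Crux `ChessboardParticlePlanes.LjPlaneChessboard` (stmt-AtomisticToContinuum-6709), line `Sketch`,
# stub `heightEnumeration` — the bi-infinite enumeration of the particle planes

Let `Q` be a periodic configuration of `ℝ³` with next / previous occupied height maps `τu`, `τd`
(hypothesis `Hτ`: for an occupied height `t`, `τu t > t` is occupied with nothing occupied strictly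
in between, and symmetrically `τd t < t`), and let `c₀ > 0` be the vertical period (the height of a
period `w`, all period heights lying in `c₀ℤ`).  Then the occupied heights are enumerated by a
strictly increasing `z : ℤ → ℝ` with `z (i + 1) = τu (z i)`, `τd (z (i + 1)) = z i`, and
`z (i + n) = z i + c₀` for the number `n ≥ 1` of particle planes per vertical period.  [folklore]

PROOF.  Pick an occupied height `t₀` and define `z 0 = t₀`, `z (i + 1) = τu (z i)` for `i ≥ 0`,
`z (i - 1) = τd (z i)` for `i ≤ 0` (`Int.inductionOn'`); every `z i` is occupied, and
`z (i + 1) = τu (z i)` holds for ALL `i` because `τu ∘ τd = id` on occupied heights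
(`heightEnumeration_tau_up_dn`).  Strict monotonicity is `t < τu t` step by step.  The height
`t₀ + c₀` is occupied (`sumToMin_occ_shift`); the strictly increasing sequence `(z k)_{k ∈ ℕ}` of
occupied heights cannot stay in the window `[t₀, t₀ + c₀]`, which contains only finitely many
occupied heights (`adjacentHeights_finite`), so there is a least `n` with `z n ≥ t₀ + c₀`; `n ≥ 1`,
and `z n = τu (z (n - 1)) ≤ t₀ + c₀` because `τu` of an occupied height is the least occupied height
above it (`sumToMin_tau_up_le`): `z n = t₀ + c₀`.  The period rule `z (i + n) = z i + c₀` then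
propagates from `i = 0` upwards by `τu (t + c₀) = τu t + c₀` (`sumToMin_tau_up_shift`) and
downwards by `τd (t + c₀) = τd t + c₀` (`sumToMin_tau_dn_shift`).  Finally `z (i + nk) = z i + c₀ k`
makes `z` unbounded in both directions, so an occupied height `t` lies in a window
`z i ≤ t < z (i + 1) = τu (z i)` (`Int.exists_greatest_of_bdd`), and the adjacency clause of `Hτ`
at `z i` forces `t = z i`.

No definition and no notation is introduced.
-/

noncomputable section

namespace Summit.AtomisticToContinuum.Crystallization.Theorems.ChessboardParticlePlanesLjPlaneChessboard

open Literature.MathematicalPhysics.StatisticalMechanics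

section Chain

variable {Q : PeriodicConfiguration 3} {c₀ : ℝ} {τu τd : ℝ → ℝ} {w : EuclideanSpace ℝ (Fin 3)}

variable (Hτ : ∀ t : ℝ, (∃ x ∈ Q.points, x 2 = t) →
    (t < τu t ∧ (∃ x ∈ Q.points, x 2 = τu t) ∧ (∀ x ∈ Q.points, x 2 ≤ t ∨ τu t ≤ x 2)) ∧
    (τd t < t ∧ (∃ x ∈ Q.points, x 2 = τd t) ∧ (∀ x ∈ Q.points, x 2 ≤ τd t ∨ t ≤ x 2)))
include Hτ

/-- Next-of-previous is the identity on occupied heights: `τu (τd t) = t` (the companion of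
`sumToMin_tau_dn_up`). [folklore] -/
theorem heightEnumeration_tau_up_dn {t : ℝ} (ht : ∃ x ∈ Q.points, x 2 = t) : τu (τd t) = t := by
  have hd := (Hτ t ht).2
  have hu := (Hτ (τd t) hd.2.1).1
  refine le_antisymm (sumToMin_tau_up_le Hτ hd.2.1 ht hd.1) ?_
  obtain ⟨x, hx, hx2⟩ := hu.2.1
  rcases hd.2.2 x hx with h | h
  · rw [hx2] at h
    exact absurd h (not_le.2 hu.1)
  · rwa [hx2] at h

/-- **The chain through an occupied height.**  For an occupied height `t₀` there is `z : ℤ → ℝ`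
with `z 0 = t₀`, every `z i` occupied, and `z (i + 1) = τu (z i)` for all `i : ℤ`
(`z (i + 1) = τu (z i)` upwards, `z (i - 1) = τd (z i)` downwards, glued by `τu ∘ τd = id`).
[folklore] -/
theorem heightEnumeration_chain {t₀ : ℝ} (ht₀ : ∃ x ∈ Q.points, x 2 = t₀) :
    ∃ z : ℤ → ℝ, z 0 = t₀ ∧ (∀ i, ∃ x ∈ Q.points, x 2 = z i) ∧ ∀ i, z (i + 1) = τu (z i) := by
  let z : ℤ → ℝ := fun i =>
    Int.inductionOn' (motive := fun _ => ℝ) i 0 t₀ (fun _ _ s => τu s) (fun _ _ s => τd s)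
  have hz0 : z 0 = t₀ := Int.inductionOn'_self
  have hup : ∀ i : ℤ, 0 ≤ i → z (i + 1) = τu (z i) := fun i hi => Int.inductionOn'_add_one hi
  have hdn : ∀ i : ℤ, i ≤ 0 → z (i - 1) = τd (z i) := fun i hi => Int.inductionOn'_sub_one hi
  have hocc : ∀ i, ∃ x ∈ Q.points, x 2 = z i := by
    intro i
    induction i using Int.induction_on with
    | zero => rw [hz0]; exact ht₀
    | succ i ih =>
      rw [hup i (by positivity)]
      exact (Hτ _ ih).1.2.1
    | pred i ih =>
      rw [hdn (-(i : ℤ)) (by omega)]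
      exact (Hτ _ ih).2.2.1
  refine ⟨z, hz0, hocc, fun i => ?_⟩
  rcases le_or_gt 0 i with hi | hi
  · exact hup i hi
  · have h := hdn (i + 1) (by omega)
    rw [add_sub_cancel_right] at h
    rw [h, heightEnumeration_tau_up_dn Hτ (hocc (i + 1))]

/-- **Planes per period.**  A chain `z` of occupied heights with `z (i + 1) = τu (z i)` returns to
its class after a positive number `n` of steps: `z n = z 0 + c₀`, `c₀ > 0` the vertical period
(`z 0 + c₀` is occupied, only finitely many occupied heights lie in `[z 0, z 0 + c₀]`, and `τu`
of an occupied height is the least occupied height above it, so the strictly increasing chain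
cannot skip `z 0 + c₀`). [folklore] -/
theorem heightEnumeration_period (hc₀ : 0 < c₀) (hG : ∀ g ∈ Q.lattice, ∃ k : ℤ, g 2 = c₀ * k)
    (hw : w ∈ Q.lattice) (hw2 : w 2 = c₀) {z : ℤ → ℝ} (hocc : ∀ i, ∃ x ∈ Q.points, x 2 = z i)
    (hsucc : ∀ i, z (i + 1) = τu (z i)) : ∃ n : ℕ, 0 < n ∧ z n = z 0 + c₀ := by
  classical
  -- the chain is strictly increasing
  have hmono : StrictMono z := strictMono_int_of_lt_succ fun i => by
    rw [hsucc]
    exact (Hτ _ (hocc i)).1.1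
  -- `z 0 + c₀` is occupied
  have hocc' : ∃ x ∈ Q.points, x 2 = z 0 + c₀ := by
    simpa using sumToMin_occ_shift hw hw2 (hocc 0) 1
  -- the chain leaves the window `[z 0, z 0 + c₀)`, which holds finitely many occupied heights
  have hex : ∃ k : ℕ, z 0 + c₀ ≤ z k := by
    by_contra h
    push Not at h
    refine (adjacentHeights_finite Q hc₀ hG (z 0) (z 0 + c₀)).not_infinite
      (Set.infinite_of_injective_forall_mem (f := fun k : ℕ => z k) (fun a b hab => ?_)
        fun k => ⟨hocc k, hmono.monotone (by positivity), (h k).le⟩)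
    exact_mod_cast hmono.injective hab
  -- at the least such index `n ≥ 1` the chain sits exactly at `z 0 + c₀`
  have hn : z 0 + c₀ ≤ z (Nat.find hex) := Nat.find_spec hex
  have hn0 : 0 < Nat.find hex := by
    rw [Nat.find_pos]
    push_cast
    linarith
  refine ⟨Nat.find hex, hn0, le_antisymm ?_ hn⟩
  obtain ⟨m, hm⟩ := Nat.exists_eq_succ_of_ne_zero hn0.ne'
  have hlt : z m < z 0 + c₀ := not_le.1 (Nat.find_min hex (show m < Nat.find hex by omega))
  rw [hm]
  push_cast
  rw [hsucc]
  exact sumToMin_tau_up_le Hτ (hocc m) hocc' hlt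

end Chain

/-- **Registered sub-goal `heightEnumeration` (bi-infinite enumeration of the particle planes).**
For a periodic configuration `Q` of `ℝ³` whose occupied heights are pairwise equal or `≥ 3/4`
apart, with next / previous occupied height maps `τu`, `τd` and vertical period `c₀ > 0` (the
height of a period; all period heights in `c₀ℤ`), there are `n ≥ 1` and a strictly increasing
enumeration `z : ℤ → ℝ` of ALL occupied heights with `z (i + 1) = τu (z i)`, `τd (z (i + 1)) = z i`
and `z (i + n) = z i + c₀` (`n` = number of particle planes per vertical period). [folklore] -/
theorem heightEnumeration :
    ∀ (Q : PeriodicConfiguration 3) (τu τd : ℝ → ℝ) (c₀ : ℝ),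
      (∀ x ∈ Q.points, ∀ y ∈ Q.points, x 2 ≠ y 2 → (3 : ℝ) / 4 ≤ |x 2 - y 2|) →
      (∀ t : ℝ, (∃ x ∈ Q.points, x 2 = t) →
        (t < τu t ∧ (∃ x ∈ Q.points, x 2 = τu t) ∧ (∀ x ∈ Q.points, x 2 ≤ t ∨ τu t ≤ x 2)) ∧
        (τd t < t ∧ (∃ x ∈ Q.points, x 2 = τd t) ∧ (∀ x ∈ Q.points, x 2 ≤ τd t ∨ t ≤ x 2))) →
      0 < c₀ → (∃ g ∈ Q.lattice, g 2 = c₀) → (∀ g ∈ Q.lattice, ∃ k : ℤ, g 2 = c₀ * k) →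
      ∃ (n : ℕ) (z : ℤ → ℝ), 0 < n ∧ StrictMono z ∧ (∀ i, z (i + 1) = τu (z i)) ∧
        (∀ i, τd (z (i + 1)) = z i) ∧ (∀ i, z (i + n) = z i + c₀) ∧
        (∀ i, ∃ x ∈ Q.points, x 2 = z i) ∧
        ∀ t : ℝ, (∃ x ∈ Q.points, x 2 = t) → ∃ i, z i = t := by
  rintro Q τu τd c₀ - Hτ hc₀ ⟨w, hw, hw2⟩ hG
  -- the chain through an occupied height `x₀ 2` and its period `n`
  obtain ⟨x₀, hx₀⟩ := Q.points_nonempty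
  obtain ⟨z, -, hocc, hsucc⟩ := heightEnumeration_chain Hτ ⟨x₀, hx₀, rfl⟩
  obtain ⟨n, hn, hzn⟩ := heightEnumeration_period Hτ hc₀ hG hw hw2 hocc hsucc
  have hmono : StrictMono z := strictMono_int_of_lt_succ fun i => by
    rw [hsucc]
    exact (Hτ _ (hocc i)).1.1
  have hpred : ∀ i, τd (z (i + 1)) = z i := fun i => by
    rw [hsucc]
    exact sumToMin_tau_dn_up Hτ (hocc i)
  -- the period rule, propagated from `i = 0` by `τu (t + c₀) = τu t + c₀`, `τd (t + c₀) = τd t + c₀`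
  have hper : ∀ i : ℤ, z (i + n) = z i + c₀ := by
    intro i
    induction i using Int.induction_on with
    | zero => simpa using hzn
    | succ i ih =>
      have e : (i : ℤ) + 1 + n = (i + n) + 1 := by ring
      rw [e, hsucc, ih, hsucc]
      simpa using sumToMin_tau_up_shift Hτ hw hw2 (hocc i) 1
    | pred i ih =>
      have e : -(i : ℤ) + n = (-(i : ℤ) - 1 + n) + 1 := by ring
      rw [e] at ih
      rw [← hpred (-(i : ℤ) - 1 + n), ih, ← hpred (-(i : ℤ) - 1), sub_add_cancel]
      simpa using sumToMin_tau_dn_shift Hτ hw hw2 (hocc (-(i : ℤ))) 1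
  -- multiples of the period: `z (i + n k) = z i + c₀ k`
  have hperk : ∀ (i : ℤ) (k : ℕ), z (i + n * k) = z i + c₀ * k := by
    intro i k
    induction k with
    | zero => simp
    | succ k ih =>
      have e : i + (n : ℤ) * ((k + 1 : ℕ) : ℤ) = (i + n * k) + n := by push_cast; ring
      rw [e, hper, ih]
      push_cast
      ring
  refine ⟨n, z, hn, hmono, hsucc, hpred, hper, hocc, fun t ht => ?_⟩
  -- an occupied height `t` lies in a window `z i ≤ t < z (i + 1)` ...
  obtain ⟨k₁, hk₁⟩ := exists_nat_gt ((t - z 0) / c₀)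
  obtain ⟨k₂, hk₂⟩ := exists_nat_gt ((z 0 - t) / c₀)
  rw [div_lt_iff₀ hc₀] at hk₁ hk₂
  have hbdd : ∀ i : ℤ, z i ≤ t → i ≤ n * k₁ := by
    intro i hi
    by_contra h
    push Not at h
    have h1 : z (n * k₁) < z i := hmono h
    have h2 := hperk 0 k₁
    rw [zero_add] at h2
    linarith
  have hne : ∃ i : ℤ, z i ≤ t := by
    refine ⟨-(n * k₂ : ℤ), ?_⟩
    have h2 := hperk (-(n * k₂ : ℤ)) k₂
    rw [neg_add_cancel] at h2
    linarith
  obtain ⟨i, hi, himax⟩ := Int.exists_greatest_of_bdd ⟨_, hbdd⟩ hne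
  have hlt : t < z (i + 1) := by
    by_contra h
    push Not at h
    have := himax (i + 1) h
    omega
  -- ... and the adjacency clause at `z i` forces `t = z i`
  refine ⟨i, ?_⟩
  obtain ⟨x, hx, rfl⟩ := ht
  rcases (Hτ _ (hocc i)).1.2.2 x hx with h | h
  · exact le_antisymm hi h
  · rw [← hsucc] at h
    exact absurd h (not_le.2 hlt)

end Summit.AtomisticToContinuum.Crystallization.Theorems.ChessboardParticlePlanesLjPlaneChessboard

end
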